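import Mathlib
import HarnessLib
import Literature.MathematicalPhysics.QuantumFieldTheory.Balaban1983to89.B10Eq70Squaring
import Literature.MathematicalPhysics.QuantumFieldTheory.Balaban1983to89.B10Eq70Concrete

/-!
# `Balaban1983to89.B10Eq71Concrete` — [Balaban1985UV3] p. 273, **(68) ⇒ (69) ⇒ (70) ⇒ (71)** end to end for the
# CONCRETE `j`-fold average (43) of [Balaban1985Averaging] on `ℤ³`: *"the part of the action (1/g_k²)A^η(U_k) localized
# to the sum of four j-blocks Δ′ connected with the plaquette p′ can be bounded from below by ¼p²(g_j)"* — the knit of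
# `B10Eq69Concrete` (seat p29: (69)) with `B10Eq70Squaring` (this unit: (70), (71))

T. Bałaban, *Ultraviolet stability of three-dimensional lattice pure gauge field theories*, Commun. Math. Phys. **102**,
255–275 (1985) [Balaban1985UV3] (cell paper B10; journal page = PDF page + 254; p. 273 re-read on the render
`run/shared/lean/pub/pub-balaban/b2b-balaban-ref1/pages/1985-cmp102-uv-stability-3d/…-p019-x2.png`, 2026-08-21).

HONEST FRAMING (mega-formalization `lit-balaban`, verbatim): statement-level skeleton of published theorems with
citation tags; proofs where landed; nothing here is a claim about the Yang–Mills mass gap.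

WHY THIS FILE EXISTS.  Unit `lit-balaban-r07` (reader/typer of B10, fold owner), gen 6; SKELETON rows B10.Eq69–Eq71.
Two Phase-2 files landed the pieces of Sect. D's large-field argument for the concrete objects of [4]: `B10Eq69Concrete`
(seat p29 gen 4: (69) `eq69_concrete` — `|Ū^j(∂p′) − 1| ≤ Σ_{x∈B^j(x₀)} L^{−dj} Σ_{p⊂(p′)_x} |U(∂p) − 1| + (16/3)C₀α₀²`
for the `j`-fold average `B7Prop2Explicit.avgIter` under (68) in the form `sup_p |U(∂p) − 1| < α₀L^{−2j}`) and
`B10Eq70Squaring` (this unit: (70) both lines, `Δ′` = the four `j`-blocks, (71), `smallFactor_of_largeField_le`, with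
(69) as a HYPOTHESIS on the block sum `blockSum`/`B7Eq50Linear.blockFineAvg`).  This file identifies p29's (69) sum
`B10Eq69Concrete.transSum` with `blockSum … (dev U)` (`transSum_eq_blockSum`) and discharges the (69) hypothesis, giving
the printed conclusion of (71) for the concrete average with (67) `V_j = Ū_k^j` a definitional renaming.

THE PRINTED TEXT (p. 273 [19], verbatim; (67)–(71) quoted in full in `B10Eq70Squaring`): *"… This inequality can be
written finally as (1/g_k²) Σ_{p⊂Δ′} η⁻¹[1 − Re tr U_k(∂p)] ≥ (1/2g_j²)|V_j(∂p′) − 1|² − O(1)g_jp³(g_j) ≥ ½p²(g_j) −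
O(1)g_jp³(g_j) ≥ ¼p²(g_j) (71) for g_j sufficiently small. Thus the part of the action 1/g_k²A^η(U_k) localized to
the sum of four j-blocks Δ′ connected with the plaquette p′ can be bounded from below by 1/4p²(g_j), and the
corresponding part of the exponential gives the small factor exp(−1/4p²(g_j))."*

DICTIONARY print ↦ Lean (as in `B10Eq70Squaring` / `B10Eq69Concrete`; `d = 3`): `U_k` ↦ `U : Site 3 → Fin 3 → 𝔸ˣ`
with values in an admissible gauge group `G` (`B7Prop2Explicit.AvgClosed`; `U(N)`: `unitaryUnits`); `V_j = Ū_k^j` on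
`Λ_j` ((67)) ↦ `avgIter L U j`; the large-field plaquette `p′ ⊂ Λ_j` ↦ the level-`j` plaquette at `z₀` spanned by
`e_μ, e_ν`, `|V_j(∂p′) − 1| ≥ g_jp(g_j)` ↦ `hLF`; (68) `|U_k(∂p) − 1| < O(1)g_jp(g_j)L^{−2j}` ↦ `pdev U < α₀(L^j)⁻²` with
`α₀ ≤ C₁·g_jp(g_j)` (`hαε`; print's O(1) = `C₁`); the action density ↦ `act` with `|U(∂p) − 1|² ≤ 2·act(p)` on `Δ′`
((11); for `U(N)` `act(p) = N(1 − Re tr U(∂p))`, `B10Eq70Squaring.dev_sq_le_two_act_unitary`); `g_k² = g_j²L^{k−j}`,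
`η⁻¹ = L^k`; *"for g_j sufficiently small"* ↦ `hsmall : ½(2C₁C₂ + C₂²)·g_jp(g_j) ≤ ¼` with `C₂ = (16/3)C₀C₁²`
(`C₀ = B7Prop2Explicit.C0 3`, the constant of Prop. 1 of [4]).

WHAT THIS FILE PROVES (kernel, no `sorry`, theorems only, no new definitions or named facts; axioms standard).
* `transSum_eq_blockSum` — `B10Eq69Concrete.transSum L U μ ν j z = blockSum (L^j) (L^j•z) μ ν (dev U μ ν)`.
* `smallFactor_concrete` — **(68) ⇒ (69) ⇒ (70) ⇒ (71) for the concrete average:** under the smallness of Prop. 2 of [4]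
  (`0 < α₀`, `C₀α₀ ≤ ⅓`, `2α₀ ≤ c₂′`), (68) `pdev U < α₀(L^j)⁻²`, `α₀ ≤ C₁g_jp(g_j)`, `g_jp(g_j) ≤ |Ū^j(∂p′) − 1|`,
  `|U(∂p) − 1|² ≤ 2·act(p)` on `Δ′`, `g_k² = g_j²L^{k−j}`, `g_jp(g_j) ≤ 1` and `hsmall`:
  `¼p² ≤ (1/g_k²)·L^k·Σ_{p⊂Δ′} act(p)`; `exp_localized_le_concrete` — the factor `exp(−¼p²(g_j))`.
* `smallFactor_unitaryGroup` — the same for `G = U(N) ⊂ M_N(ℂ)` (operator norm) with `act(p) = N(1 − Re tr U(∂p))`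
  supplied by (11) (`B10Eq11Trace.eq11_opNorm`), i.e. `¼p² ≤ (N/g_k²)·L^k·Σ_{p⊂Δ′}[1 − Re tr U(∂p)]` — the dimension
  factor of cell DIVERGENCE D-b10.1 displayed.

v1.1 (same unit, append-only §4): the SEMISIMPLE case of Theorem 1 (p. 257: *"with a semi-simple compact group Lie G"*) —
`smallFactor_concrete_at` (gauge groups closed under the average only at a radius `t`, `B7Prop2SpecialUnitary.AvgClosedAt`,
via p29's `eq69_at`) and **`smallFactor_specialUnitary`** (`G = SU(N) ⊂ M_N(ℂ)`, operator norm; the one extra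
`G`-dependent smallness `N·32(d+1)(d+4)L²α₀ < π` of `avgClosedAt_specialUnitary`), with the (11) step for `SU(N)`-valued
holonomies (`dev_sq_le_two_act_specialUnitary`).

Value = rows B10.Eq69–Eq71 knitted into one kernel statement for the paper's concrete objects; NOT summit progress.
-/

noncomputable section

open scoped BigOperators
open Finset

namespace Literature.MathematicalPhysics.QuantumFieldTheory.Balaban1983to89.B10Eq71Concrete

open B7Prop1Explicit B7Prop2Explicit B10Eq70Squaring

export B7Prop1Explicit (Site) -- the `ℤ^d` sites (the torus `Site` of `Setup.lean` would shadow them)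

variable {d : ℕ}

/-! ## §1 The (69) sum of `B10Eq69Concrete` is the block sum of `B10Eq70Squaring` -/

section Bridge

variable {𝔸 : Type*} [NormedRing 𝔸]

/-- **One sum, two spellings:** p29's `transSum L U μ ν j z = Σ_{r} L^{−dj}·fineSum (L^j) U (L^j z + boxVec r) μ ν`
((69), `B10Eq69Concrete`) equals `blockSum (L^j) (L^j•z) μ ν (dev U μ ν)` of `B10Eq70Squaring` (via
`blockSum_dev_eq_blockFineAvg`; `L^{−dj} = ((L^j)^d)⁻¹`, `(L^j : ℤ)•z = (L^j : ℕ)•z`). [cite: Balaban1985UV3, (69) p.273] -/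
theorem transSum_eq_blockSum (L : ℕ) (U : Site d → Fin d → 𝔸ˣ) (μ ν : Fin d) (j : ℕ) (z : Site d) :
    B10Eq69Concrete.transSum L U μ ν j z = blockSum (L ^ j) ((L ^ j : ℕ) • z) μ ν (dev U μ ν) := by
  rw [blockSum_dev_eq_blockFineAvg]
  unfold B10Eq69Concrete.transSum B10Eq69Concrete.transSumN B7Eq50Linear.blockFineAvg
  have hw : ((L : ℝ) ^ (d * j))⁻¹ = ((((L ^ j : ℕ) : ℝ)) ^ d)⁻¹ := by
    push_cast
    rw [← pow_mul, mul_comm]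
  have hz : (((L ^ j : ℕ) : ℤ)) • z = (L ^ j : ℕ) • z := Nat.cast_smul_eq_nsmul ℤ (L ^ j) z
  simp only [hw, hz]

end Bridge

/-! ## §2 (68) ⇒ (69) ⇒ (70) ⇒ (71) for the concrete `j`-fold average on `ℤ³` -/

section Concrete

variable {𝔸 : Type*} [NormedRing 𝔸] [NormOneClass 𝔸] [NormedAlgebra ℂ 𝔸] [CompleteSpace 𝔸]

/-- **Sect. D, (67)–(71) p. 273 for the CONCRETE average of [4] (d = 3):** `U` a `G`-valued fine configuration
(`G` admissible: `AvgClosed`), `Ū^j = avgIter L U j` its `j`-fold average ((67): `V_j = Ū_k^j` on `Λ_j`), `p′` the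
level-`j` plaquette at `z₀` spanned by `e_μ ≠ e_ν` with `|Ū^j(∂p′) − 1| ≥ g_jp(g_j)` (large field); (68) as
`sup_p |U(∂p) − 1| < α₀(L^j)⁻²` with `α₀ ≤ C₁·g_jp(g_j)` and the Prop.-2 smallness of [4]; (11) as
`|U(∂p) − 1|² ≤ 2·act(p)` on `Δ′`; `g_k² = g_j²L^{k−j}`; `g_jp(g_j) ≤ 1`; *"g_j sufficiently small"*:
`½(2C₁C₂ + C₂²)·g_jp(g_j) ≤ ¼`, `C₂ = (16/3)C₀C₁²`.  THEN **`¼p²(g_j) ≤ (1/g_k²)·L^k·Σ_{p⊂Δ′} act(p)`** — (69) is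
`B10Eq69Concrete.eq69_concrete` (seat p29), (70)–(71) are `B10Eq70Squaring.smallFactor_of_largeField_le`.
[cite: Balaban1985UV3, (67)–(71) p.273] -/
theorem smallFactor_concrete (L : ℕ) (hL : 2 ≤ L) {G : Subgroup 𝔸ˣ} (hG : AvgClosed 3 L G) (j k : ℕ) (hjk : j ≤ k)
    (U : Site 3 → Fin 3 → 𝔸ˣ) (hU : ∀ x κ, U x κ ∈ G) (z₀ : Site 3) {μ ν : Fin 3} (hμν : μ ≠ ν)
    (act : Site 3 → ℝ) (hact : ∀ y ∈ deltaBox (L ^ j) ((L ^ j : ℕ) • z₀) μ ν, dev U μ ν y ^ 2 ≤ 2 * act y)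
    {gj gk p α₀ C₁ : ℝ} (hgj : 0 < gj) (hgk : gk ^ 2 = gj ^ 2 * (L : ℝ) ^ (k - j)) (hp : 0 ≤ p) (hgp : gj * p ≤ 1)
    (hα : 0 < α₀) (hα3 : C0 3 * α₀ ≤ 1 / 3) (hα2 : 2 * α₀ ≤ c2' 3 L)
    (h68 : pdev U < α₀ * (((L : ℝ) ^ j)⁻¹) ^ 2) (hαε : α₀ ≤ C₁ * (gj * p))
    (hLF : gj * p ≤ ‖((hol (avgIter L U j) z₀ (plaqWord μ ν) : 𝔸ˣ) : 𝔸) - 1‖)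
    (hsmall : (2 * C₁ * (16 / 3 * C0 3 * C₁ ^ 2) + (16 / 3 * C0 3 * C₁ ^ 2) ^ 2) / 2 * gj * p ≤ 1 / 4) :
    p ^ 2 / 4 ≤ (gk ^ 2)⁻¹ * ((L : ℝ) ^ k * ∑ y ∈ deltaBox (L ^ j) ((L ^ j : ℕ) • z₀) μ ν, act y) := by
  have hL1 : 1 ≤ L := le_trans (by norm_num) hL
  have hLpos : (0 : ℝ) < (L : ℝ) ^ j := pow_pos (by exact_mod_cast (by omega : 0 < L)) _
  have hGU : G ≤ U1 𝔸 := hG.le_U1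
  have hUU : ∀ x κ, U x κ ∈ U1 𝔸 := fun x κ => hGU (hU x κ)
  have hε0 : 0 ≤ gj * p := by positivity
  -- (69) for the concrete average, rewritten on the block sum of `B10Eq70Squaring` / `B7Eq50Linear`
  have h69 := B10Eq69Concrete.eq69_concrete L hL hG j U hU hα hα3 hα2 h68 z₀ hμν
  rw [transSum_eq_blockSum, blockSum_dev_eq_blockFineAvg] at h69
  -- (68) pointwise on the sub-plaquettes: |U(∂p) − 1| ≤ sup ≤ α₀(L^j)⁻² ≤ C₁ g_j p (L^j)⁻²
  have h68pt : ∀ t : Idx 3 (L ^ j), dev U μ ν (corner (L ^ j) ((L ^ j : ℕ) • z₀) μ ν t) ≤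
      C₁ * (gj * p) / ((L : ℝ) ^ j) ^ 2 := by
    intro t
    have h1 : dev U μ ν (corner (L ^ j) ((L ^ j : ℕ) • z₀) μ ν t) ≤ pdev U := le_pdev hUU _ μ ν
    have h2 : α₀ * (((L : ℝ) ^ j)⁻¹) ^ 2 ≤ C₁ * (gj * p) / ((L : ℝ) ^ j) ^ 2 := by
      rw [inv_pow, ← div_eq_mul_inv]
      exact div_le_div_of_nonneg_right hαε (by positivity)
    linarith
  -- the remainder of (69): b = (16/3)C₀α₀² ≤ C₂ (g_j p)², C₂ = (16/3)C₀C₁²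
  have hC0 : 0 < C0 3 := C0_pos 3
  have hb : 0 ≤ 16 / 3 * C0 3 * α₀ ^ 2 := by positivity
  have hbB : 16 / 3 * C0 3 * α₀ ^ 2 ≤ (16 / 3 * C0 3 * C₁ ^ 2) * (gj * p) ^ 2 := by
    have hsq : α₀ ^ 2 ≤ (C₁ * (gj * p)) ^ 2 := pow_le_pow_left₀ hα.le hαε 2
    nlinarith
  exact smallFactor_of_largeField_le L hL1 j k hjk U (avgIter L U j) z₀ hμν act hact hgj hgk hp hgp rfl hLF
    h68pt h69 hb hbB hsmall

/-- **The small factor for the concrete average:** under the hypotheses of `smallFactor_concrete`,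
`exp[−(1/g_k²)·L^k·Σ_{p⊂Δ′} act(p)] ≤ exp(−¼p²(g_j))` (p. 273: *"the corresponding part of the exponential gives the
small factor exp(−1/4p²(g_j))"*). [cite: Balaban1985UV3, (71) p.273] -/
theorem exp_localized_le_concrete (L : ℕ) (hL : 2 ≤ L) {G : Subgroup 𝔸ˣ} (hG : AvgClosed 3 L G) (j k : ℕ)
    (hjk : j ≤ k) (U : Site 3 → Fin 3 → 𝔸ˣ) (hU : ∀ x κ, U x κ ∈ G) (z₀ : Site 3) {μ ν : Fin 3} (hμν : μ ≠ ν)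
    (act : Site 3 → ℝ) (hact : ∀ y ∈ deltaBox (L ^ j) ((L ^ j : ℕ) • z₀) μ ν, dev U μ ν y ^ 2 ≤ 2 * act y)
    {gj gk p α₀ C₁ : ℝ} (hgj : 0 < gj) (hgk : gk ^ 2 = gj ^ 2 * (L : ℝ) ^ (k - j)) (hp : 0 ≤ p) (hgp : gj * p ≤ 1)
    (hα : 0 < α₀) (hα3 : C0 3 * α₀ ≤ 1 / 3) (hα2 : 2 * α₀ ≤ c2' 3 L)
    (h68 : pdev U < α₀ * (((L : ℝ) ^ j)⁻¹) ^ 2) (hαε : α₀ ≤ C₁ * (gj * p))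
    (hLF : gj * p ≤ ‖((hol (avgIter L U j) z₀ (plaqWord μ ν) : 𝔸ˣ) : 𝔸) - 1‖)
    (hsmall : (2 * C₁ * (16 / 3 * C0 3 * C₁ ^ 2) + (16 / 3 * C0 3 * C₁ ^ 2) ^ 2) / 2 * gj * p ≤ 1 / 4) :
    Real.exp (-((gk ^ 2)⁻¹ * ((L : ℝ) ^ k * ∑ y ∈ deltaBox (L ^ j) ((L ^ j : ℕ) • z₀) μ ν, act y))) ≤
      Real.exp (-(p ^ 2 / 4)) := by
  have h := smallFactor_concrete L hL hG j k hjk U hU z₀ hμν act hact hgj hgk hp hgp hα hα3 hα2 h68 hαε hLF hsmall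
  exact Real.exp_le_exp.mpr (by linarith)

end Concrete

/-! ## §3 The paper's gauge group `G = U(N) ⊂ M_N(ℂ)`, operator norm (19) of [4] -/

section Matrices

open scoped Matrix.Norms.L2Operator

/-- **(68) ⇒ (69) ⇒ (70) ⇒ (71) for `G = U(N)`, `N ≥ 1`, operator norm:** with `act(p) = N(1 − Re tr U(∂p))`
(`tr = N⁻¹Tr`; the (11) step supplied by `B10Eq70Squaring.dev_sq_le_two_act_unitary` ← `B10Eq11Trace.eq11_opNorm`),
`¼p²(g_j) ≤ (1/g_k²)·L^k·Σ_{p⊂Δ′} N(1 − Re tr U(∂p))` — the localized Wilson action of (71) with the dimension factor of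
cell DIVERGENCE D-b10.1 (operator-norm reading of `|·|`). [cite: Balaban1985UV3, (67)–(71) p.273] -/
theorem smallFactor_unitaryGroup (N : ℕ) [NeZero N] (L : ℕ) (hL : 2 ≤ L) (j k : ℕ) (hjk : j ≤ k)
    (U : Site 3 → Fin 3 → (Matrix (Fin N) (Fin N) ℂ)ˣ) (hU : ∀ x κ, U x κ ∈ unitaryUnits (Matrix (Fin N) (Fin N) ℂ))
    (z₀ : Site 3) {μ ν : Fin 3} (hμν : μ ≠ ν)
    {gj gk p α₀ C₁ : ℝ} (hgj : 0 < gj) (hgk : gk ^ 2 = gj ^ 2 * (L : ℝ) ^ (k - j)) (hp : 0 ≤ p) (hgp : gj * p ≤ 1)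
    (hα : 0 < α₀) (hα3 : C0 3 * α₀ ≤ 1 / 3) (hα2 : 2 * α₀ ≤ c2' 3 L)
    (h68 : pdev U < α₀ * (((L : ℝ) ^ j)⁻¹) ^ 2) (hαε : α₀ ≤ C₁ * (gj * p))
    (hLF : gj * p ≤
      ‖((hol (avgIter L U j) z₀ (plaqWord μ ν) : (Matrix (Fin N) (Fin N) ℂ)ˣ) : Matrix (Fin N) (Fin N) ℂ) - 1‖)
    (hsmall : (2 * C₁ * (16 / 3 * C0 3 * C₁ ^ 2) + (16 / 3 * C0 3 * C₁ ^ 2) ^ 2) / 2 * gj * p ≤ 1 / 4) :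
    p ^ 2 / 4 ≤ (gk ^ 2)⁻¹ * ((L : ℝ) ^ k *
      ∑ y ∈ deltaBox (L ^ j) ((L ^ j : ℕ) • z₀) μ ν,
        (N : ℝ) * (1 - (N : ℝ)⁻¹ *
          (((hol U y (plaqWord μ ν) : (Matrix (Fin N) (Fin N) ℂ)ˣ) : Matrix (Fin N) (Fin N) ℂ).trace.re))) := by
  letI : CStarAlgebra (Matrix (Fin N) (Fin N) ℂ) := {}
  exact smallFactor_concrete L hL (avgClosed_unitaryUnits 3 L) j k hjk U hU z₀ hμν _
    (fun y _ => dev_sq_le_two_act_unitary U hU μ ν y) hgj hgk hp hgp hα hα3 hα2 h68 hαε hLF hsmall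

end Matrices

/-! ## §4 (v1.1) Gauge groups closed at a radius (`AvgClosedAt`) and the semisimple case `G = SU(N)` -/

section ClosedAt

variable {𝔸 : Type*} [NormedRing 𝔸] [NormOneClass 𝔸] [NormedAlgebra ℂ 𝔸] [CompleteSpace 𝔸]

/-- **(68) ⇒ (69) ⇒ (70) ⇒ (71) for the concrete average, gauge group closed under the average at radius `t`**
(`B7Prop2SpecialUnitary.AvgClosedAt`; p29's `B10Eq69Concrete.eq69_at` with its radius clause
`32(d+1)(d+4)L²α₀ ≤ t`); otherwise as `smallFactor_concrete`. [cite: Balaban1985UV3, (67)–(71) p.273] -/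
theorem smallFactor_concrete_at (L : ℕ) (hL : 2 ≤ L) {G : Subgroup 𝔸ˣ} {t : ℝ}
    (hG : B7Prop2SpecialUnitary.AvgClosedAt 3 t L G) (j k : ℕ) (hjk : j ≤ k)
    (U : Site 3 → Fin 3 → 𝔸ˣ) (hU : ∀ x κ, U x κ ∈ G) (z₀ : Site 3) {μ ν : Fin 3} (hμν : μ ≠ ν)
    (act : Site 3 → ℝ) (hact : ∀ y ∈ deltaBox (L ^ j) ((L ^ j : ℕ) • z₀) μ ν, dev U μ ν y ^ 2 ≤ 2 * act y)
    {gj gk p α₀ C₁ : ℝ} (hgj : 0 < gj) (hgk : gk ^ 2 = gj ^ 2 * (L : ℝ) ^ (k - j)) (hp : 0 ≤ p) (hgp : gj * p ≤ 1)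
    (hα : 0 < α₀) (hα3 : C0 3 * α₀ ≤ 1 / 3) (hα2 : 2 * α₀ ≤ c2' 3 L)
    (hαt : 32 * ((3 : ℝ) + 1) * (3 + 4) * (L : ℝ) ^ 2 * α₀ ≤ t)
    (h68 : pdev U < α₀ * (((L : ℝ) ^ j)⁻¹) ^ 2) (hαε : α₀ ≤ C₁ * (gj * p))
    (hLF : gj * p ≤ ‖((hol (avgIter L U j) z₀ (plaqWord μ ν) : 𝔸ˣ) : 𝔸) - 1‖)
    (hsmall : (2 * C₁ * (16 / 3 * C0 3 * C₁ ^ 2) + (16 / 3 * C0 3 * C₁ ^ 2) ^ 2) / 2 * gj * p ≤ 1 / 4) :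
    p ^ 2 / 4 ≤ (gk ^ 2)⁻¹ * ((L : ℝ) ^ k * ∑ y ∈ deltaBox (L ^ j) ((L ^ j : ℕ) • z₀) μ ν, act y) := by
  have hL1 : 1 ≤ L := le_trans (by norm_num) hL
  have hLpos : (0 : ℝ) < (L : ℝ) ^ j := pow_pos (by exact_mod_cast (by omega : 0 < L)) _
  have hUU : ∀ x κ, U x κ ∈ U1 𝔸 := fun x κ => hG.le_U1 (hU x κ)
  have hε0 : 0 ≤ gj * p := by positivity
  have h69 := B10Eq69Concrete.eq69_at L hL hG j U hU hα hα3 hα2 hαt h68 z₀ hμν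
  rw [transSum_eq_blockSum, blockSum_dev_eq_blockFineAvg] at h69
  have h68pt : ∀ t : Idx 3 (L ^ j), dev U μ ν (corner (L ^ j) ((L ^ j : ℕ) • z₀) μ ν t) ≤
      C₁ * (gj * p) / ((L : ℝ) ^ j) ^ 2 := by
    intro t
    have h1 : dev U μ ν (corner (L ^ j) ((L ^ j : ℕ) • z₀) μ ν t) ≤ pdev U := le_pdev hUU _ μ ν
    have h2 : α₀ * (((L : ℝ) ^ j)⁻¹) ^ 2 ≤ C₁ * (gj * p) / ((L : ℝ) ^ j) ^ 2 := by
      rw [inv_pow, ← div_eq_mul_inv]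
      exact div_le_div_of_nonneg_right hαε (by positivity)
    linarith
  have hC0 : 0 < C0 3 := C0_pos 3
  have hb : 0 ≤ 16 / 3 * C0 3 * α₀ ^ 2 := by positivity
  have hbB : 16 / 3 * C0 3 * α₀ ^ 2 ≤ (16 / 3 * C0 3 * C₁ ^ 2) * (gj * p) ^ 2 := by
    have hsq : α₀ ^ 2 ≤ (C₁ * (gj * p)) ^ 2 := pow_le_pow_left₀ hα.le hαε 2
    nlinarith
  exact smallFactor_of_largeField_le L hL1 j k hjk U (avgIter L U j) z₀ hμν act hact hgj hgk hp hgp rfl hLF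
    h68pt h69 hb hbB hsmall

end ClosedAt

section SpecialUnitary

open scoped Matrix.Norms.L2Operator
open B7Prop2SpecialUnitary

variable {n : Type*} [Fintype n] [DecidableEq n] [Nonempty n]

/-- (11) p. 258 feeding (70) for `SU(N)`-valued configurations (operator norm): every plaquette variable is unitary, so
`|U(∂p) − 1|²_op ≤ 2·N(1 − Re tr U(∂p))` (`B10Eq11Trace.eq11_opNorm`). [cite: Balaban1985UV3, (11) p.258, (70) p.273] -/
theorem dev_sq_le_two_act_specialUnitary (U : Site d → Fin d → (Matrix n n ℂ)ˣ)
    (hU : ∀ x κ, U x κ ∈ specialUnitaryUnits n) (μ ν : Fin d) (y : Site d) :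
    dev U μ ν y ^ 2 ≤
      2 * ((Fintype.card n : ℝ) * (1 - (Fintype.card n : ℝ)⁻¹ *
        (((hol U y (plaqWord μ ν) : (Matrix n n ℂ)ˣ) : Matrix n n ℂ).trace.re))) := by
  have hmem : ((hol U y (plaqWord μ ν) : (Matrix n n ℂ)ˣ) : Matrix n n ℂ) ∈ Matrix.unitaryGroup n ℂ :=
    mem_unitaryUnits.mp (specialUnitaryUnits_le_unitaryUnits (hol_mem_of hU y (plaqWord μ ν)))
  have h := B10Eq11Trace.eq11_opNorm _ hmem
  unfold dev
  linarith

/-- **(68) ⇒ (69) ⇒ (70) ⇒ (71) for `G = SU(N) ⊂ M_N(ℂ)`, the semisimple case of Theorem 1** (p. 257: *"with a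
semi-simple compact group Lie G"*; operator norm (19) of [4]): with `act(p) = N(1 − Re tr U(∂p))` from (11) and the
one extra `G`-dependent smallness `N·32(d+1)(d+4)L²α₀ < π` of `avgClosedAt_specialUnitary` (the average (42) stays in
`SU(N)`), `¼p²(g_j) ≤ (1/g_k²)·L^k·Σ_{p⊂Δ′} N(1 − Re tr U(∂p))`. [cite: Balaban1985UV3, (67)–(71) p.273, Thm 1 p.257] -/
theorem smallFactor_specialUnitary (L : ℕ) (hL : 2 ≤ L) (j k : ℕ) (hjk : j ≤ k)
    (U : Site 3 → Fin 3 → (Matrix n n ℂ)ˣ) (hU : ∀ x κ, U x κ ∈ specialUnitaryUnits n)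
    (z₀ : Site 3) {μ ν : Fin 3} (hμν : μ ≠ ν)
    {gj gk p α₀ C₁ : ℝ} (hgj : 0 < gj) (hgk : gk ^ 2 = gj ^ 2 * (L : ℝ) ^ (k - j)) (hp : 0 ≤ p) (hgp : gj * p ≤ 1)
    (hα : 0 < α₀) (hα3 : C0 3 * α₀ ≤ 1 / 3) (hα2 : 2 * α₀ ≤ c2' 3 L)
    (hαN : Fintype.card n * (32 * ((3 : ℝ) + 1) * (3 + 4) * (L : ℝ) ^ 2 * α₀) < Real.pi)
    (h68 : pdev U < α₀ * (((L : ℝ) ^ j)⁻¹) ^ 2) (hαε : α₀ ≤ C₁ * (gj * p))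
    (hLF : gj * p ≤ ‖((hol (avgIter L U j) z₀ (plaqWord μ ν) : (Matrix n n ℂ)ˣ) : Matrix n n ℂ) - 1‖)
    (hsmall : (2 * C₁ * (16 / 3 * C0 3 * C₁ ^ 2) + (16 / 3 * C0 3 * C₁ ^ 2) ^ 2) / 2 * gj * p ≤ 1 / 4) :
    p ^ 2 / 4 ≤ (gk ^ 2)⁻¹ * ((L : ℝ) ^ k *
      ∑ y ∈ deltaBox (L ^ j) ((L ^ j : ℕ) • z₀) μ ν,
        (Fintype.card n : ℝ) * (1 - (Fintype.card n : ℝ)⁻¹ *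
          (((hol U y (plaqWord μ ν) : (Matrix n n ℂ)ˣ) : Matrix n n ℂ).trace.re))) := by
  letI : CStarAlgebra (Matrix n n ℂ) := {}
  -- the radius clause: 2α₀ ≤ c₂′ = 1/(512·4·7·L²) gives 32·4·7·L²α₀ ≤ 1/32 ≤ 1/4
  have hL1 : (1 : ℝ) ≤ L := by exact_mod_cast le_trans (by norm_num) hL
  have hpos : (0 : ℝ) < 512 * ((3 : ℝ) + 1) * (3 + 4) * (L : ℝ) ^ 2 := by positivity
  have ht4 : 32 * ((3 : ℝ) + 1) * (3 + 4) * (L : ℝ) ^ 2 * α₀ ≤ 1 / 4 := by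
    have h1 : 2 * α₀ ≤ 1 / (512 * ((3 : ℝ) + 1) * (3 + 4) * (L : ℝ) ^ 2) := hα2
    rw [le_div_iff₀ hpos] at h1
    nlinarith
  exact smallFactor_concrete_at L hL (avgClosedAt_specialUnitary 3 L ht4 hαN) j k hjk U hU z₀ hμν _
    (fun y _ => dev_sq_le_two_act_specialUnitary U hU μ ν y) hgj hgk hp hgp hα hα3 hα2 le_rfl h68 hαε hLF hsmall

end SpecialUnitary

end Literature.MathematicalPhysics.QuantumFieldTheory.Balaban1983to89.B10Eq71Concrete

end
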